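import Summits.Ventures.PercRepro.Night2ShapeOneGeom

/-!
# PercRepro — the seven-point shape (i): the PER-SIDE geometric package (night-2, gen 30)

For a target `S` (cell `(2, 1)`, `coloops (S ∖ K) = {w}`, `rk (S ∖ K) = 5`) and a triple `y₁, y₂, y₃` of non-coloops
with `y₂, y₃ ∈ coloops ((S ∖ K) ∖ y₁)` (a line of the seven-point shape (i), Night2ShapeOneGeom), the case-1 machinery
of gen 29 gives, with `P = ((S ∖ y₁) ∖ y₂) ∖ y₃`, `H = cl (S ∖ w)`, `A_p = cl (insert y_p P)` and the nine type counts
`n₀, n_p, z₀, z_p, zA` of the outside points `G ∖ S` (Night2OneFatCaseOneTypes): the load of each `y_p` is at most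
`(r_H + r_c + r_d − 11/18)⁺ / (1 + n_p + n₀ + z₀ + z₁ + z₂ + z₃)` (`gtLoadAt_le_of_triple` + `card_gtPts_ge_outside` +
`card_good₁`), `|G ∖ A_p| = 2 + (n₀ + n_c + n_d) + (z₀ + z_c + z_d)` (`card_sdiff_clF_face_pair` + `card_not_A₁`),
`|G ∖ H| = 1 + (z₀ + z₁ + z₂ + z₃ + zA)` (`card_sdiff_clF_erase_coloop` + `card_not_H`), and the closure property of
the three `A_p` — the inputs of the finite check Night2ShapeOneCheck, one side at a time (proofs/NIGHT-2-g30.md §5).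
-/

namespace PercRepro.Shadow

open Finset PerFlat ThmH

variable {α : Type*} [DecidableEq α] {M : Matroid α} [M.Finite] {G : Finset α}

section SidePack

set_option maxHeartbeats 1600000 in
open scoped Classical in
/-- **The per-side package.** -/
theorem shapeOne_side_package (hG : G ∈ flatsQ M (5 + 1)) (hd : (gr M \ G).card = 2)
    (hk : kColoops M G = 1) (hs : ∀ e ∈ gr M, ∀ f ∈ gr M, e ≠ f → rkN M {e, f} = 2)
    (hl : ∀ e ∈ gr M, M.Indep {e}) {S : Finset α} (hSG : S ⊆ G)
    (hKS : coloops M G ⊆ S) {w : α} (hc : coloops M (S \ coloops M G) = {w}) (hV5 : rkN M (S \ coloops M G) = 5)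
    {y₁ y₂ y₃ : α} (hy₁V : y₁ ∈ S \ coloops M G) (hy₂V : y₂ ∈ S \ coloops M G) (hy₃V : y₃ ∈ S \ coloops M G)
    (h12 : y₁ ≠ y₂) (h13 : y₁ ≠ y₃) (h23 : y₂ ≠ y₃) (hy₁c : y₁ ∉ coloops M (S \ coloops M G))
    (hc₂ : y₂ ∉ coloops M (S \ coloops M G)) (hc₃ : y₃ ∉ coloops M (S \ coloops M G))
    (hcol₂ : y₂ ∈ coloops M ((S \ coloops M G).erase y₁)) (hcol₃ : y₃ ∈ coloops M ((S \ coloops M G).erase y₁))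
    {rH : ℚ}
    (hreqw : ∀ y ∈ S \ coloops M G, y ≠ w → y ∉ coloops M (S \ coloops M G) → (y = y₁ ∨ y = y₂ ∨ y = y₃) →
      (S.erase y).erase w ∈ thinMembers M 5 G → req M 5 ((S.erase y).erase w) = rH) :
    ClosureProp (fun x => x ∈ clF M (insert y₁ (((S.erase y₁).erase y₂).erase y₃))) (fun x => x ∈ clF M (insert y₂ (((S.erase y₁).erase y₂).erase y₃))) (fun x => x ∈ clF M (insert y₃ (((S.erase y₁).erase y₂).erase y₃))) ∧
    (G \ clF M (S.erase w)).card = 1 + (typeCount (G \ S) (fun x => x ∈ clF M (S.erase w)) (fun x => x ∈ clF M (insert y₁ (((S.erase y₁).erase y₂).erase y₃))) (fun x => x ∈ clF M (insert y₂ (((S.erase y₁).erase y₂).erase y₃))) (fun x => x ∈ clF M (insert y₃ (((S.erase y₁).erase y₂).erase y₃))) false false false false + typeCount (G \ S) (fun x => x ∈ clF M (S.erase w)) (fun x => x ∈ clF M (insert y₁ (((S.erase y₁).erase y₂).erase y₃))) (fun x => x ∈ clF M (insert y₂ (((S.erase y₁).erase y₂).erase y₃))) (fun x => x ∈ clF M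 (insert y₃ (((S.erase y₁).erase y₂).erase y₃))) false true false false + typeCount (G \ S) (fun x => x ∈ clF M (S.erase w)) (fun x => x ∈ clF M (insert y₁ (((S.erase y₁).erase y₂).erase y₃))) (fun x => x ∈ clF M (insert y₂ (((S.erase y₁).erase y₂).erase y₃))) (fun x => x ∈ clF M (insert y₃ (((S.erase y₁).erase y₂).erase y₃))) false false true false + typeCount (G \ S) (fun x => x ∈ clF M (S.erase w)) (fun x => x ∈ clF M (insert y₁ (((S.erase y₁).erase y₂).erase y₃))) (fun x => x ∈ clF M (insert y₂ (((S.erase y₁).erase y₂).erase y₃))) (fun x => x ∈ clF M (insert y₃ (((S.erase y₁).erase y₂).erase y₃))) false false false true + typeCount (G \ S) (fun x => x ∈ clF M (S.erase w)) (fun x => x ∈ clF M (insert y₁ (((S.erase y₁).erase y₂).erase y₃))) (fun x => x ∈ clF M (insert y₂ (((S.erase y₁).erase y₂).erase y₃))) (fun x => x ∈ clF M (insert y₃ (((S.erase y₁).erase y₂).erase y₃))) false true true true) ∧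
    (G \ clF M (insert y₁ (((S.erase y₁).erase y₂).erase y₃))).card = 2 + (typeCount (G \ S) (fun x => x ∈ clF M (S.erase w)) (fun x => x ∈ clF M (insert y₁ (((S.erase y₁).erase y₂).erase y₃))) (fun x => x ∈ clF M (insert y₂ (((S.erase y₁).erase y₂).erase y₃))) (fun x => x ∈ clF M (insert y₃ (((S.erase y₁).erase y₂).erase y₃))) true false false false + typeCount (G \ S) (fun x => x ∈ clF M (S.erase w)) (fun x => x ∈ clF M (insert y₁ (((S.erase y₁).erase y₂).erase y₃))) (fun x => x ∈ clF M (insert y₂ (((S.erase y₁).erase y₂).erase y₃))) (fun x => x ∈ clF M (insert y₃ (((S.erase y₁).erase y₂).erase y₃))) true false true false + typeCount (G \ S) (fun x => x ∈ clF M (S.erase w)) (fun x => x ∈ clF M (insert y₁ (((S.erase y₁).erase y₂).erase y₃))) (fun x => x ∈ clF M (insert y₂ (((S.erase y₁).erase y₂).erase y₃))) (fun x => x ∈ clF M (insert y₃ (((S.erase y₁).erase y₂).erase y₃))) true false false true) + (typeCount (G \ S) (fun x => x ∈ clF M (S.erase w)) (fun x => x ∈ clF M (insert y₁ (((S.erase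 y₁).erase y₂).erase y₃))) (fun x => x ∈ clF M (insert y₂ (((S.erase y₁).erase y₂).erase y₃))) (fun x => x ∈ clF M (insert y₃ (((S.erase y₁).erase y₂).erase y₃))) false false false false + typeCount (G \ S) (fun x => x ∈ clF M (S.erase w)) (fun x => x ∈ clF M (insert y₁ (((S.erase y₁).erase y₂).erase y₃))) (fun x => x ∈ clF M (insert y₂ (((S.erase y₁).erase y₂).erase y₃))) (fun x => x ∈ clF M (insert y₃ (((S.erase y₁).erase y₂).erase y₃))) false false true false + typeCount (G \ S) (fun x => x ∈ clF M (S.erase w)) (fun x => x ∈ clF M (insert y₁ (((S.erase y₁).erase y₂).erase y₃))) (fun x => x ∈ clF M (insert y₂ (((S.erase y₁).erase y₂).erase y₃))) (fun x => x ∈ clF M (insert y₃ (((S.erase y₁).erase y₂).erase y₃))) false false false true) ∧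
    (G \ clF M (insert y₂ (((S.erase y₁).erase y₂).erase y₃))).card = 2 + (typeCount (G \ S) (fun x => x ∈ clF M (S.erase w)) (fun x => x ∈ clF M (insert y₁ (((S.erase y₁).erase y₂).erase y₃))) (fun x => x ∈ clF M (insert y₂ (((S.erase y₁).erase y₂).erase y₃))) (fun x => x ∈ clF M (insert y₃ (((S.erase y₁).erase y₂).erase y₃))) true false false false + typeCount (G \ S) (fun x => x ∈ clF M (S.erase w)) (fun x => x ∈ clF M (insert y₁ (((S.erase y₁).erase y₂).erase y₃))) (fun x => x ∈ clF M (insert y₂ (((S.erase y₁).erase y₂).erase y₃))) (fun x => x ∈ clF M (insert y₃ (((S.erase y₁).erase y₂).erase y₃))) true true false false + typeCount (G \ S) (fun x => x ∈ clF M (S.erase w)) (fun x => x ∈ clF M (insert y₁ (((S.erase y₁).erase y₂).erase y₃))) (fun x => x ∈ clF M (insert y₂ (((S.erase y₁).erase y₂).erase y₃))) (fun x => x ∈ clF M (insert y₃ (((S.erase y₁).erase y₂).erase y₃))) true false false true) + (typeCount (G \ S) (fun x => x ∈ clF M (S.erase w)) (fun x => x ∈ clF M (insert y₁ (((S.erase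 y₁).erase y₂).erase y₃))) (fun x => x ∈ clF M (insert y₂ (((S.erase y₁).erase y₂).erase y₃))) (fun x => x ∈ clF M (insert y₃ (((S.erase y₁).erase y₂).erase y₃))) false false false false + typeCount (G \ S) (fun x => x ∈ clF M (S.erase w)) (fun x => x ∈ clF M (insert y₁ (((S.erase y₁).erase y₂).erase y₃))) (fun x => x ∈ clF M (insert y₂ (((S.erase y₁).erase y₂).erase y₃))) (fun x => x ∈ clF M (insert y₃ (((S.erase y₁).erase y₂).erase y₃))) false true false false + typeCount (G \ S) (fun x => x ∈ clF M (S.erase w)) (fun x => x ∈ clF M (insert y₁ (((S.erase y₁).erase y₂).erase y₃))) (fun x => x ∈ clF M (insert y₂ (((S.erase y₁).erase y₂).erase y₃))) (fun x => x ∈ clF M (insert y₃ (((S.erase y₁).erase y₂).erase y₃))) false false false true) ∧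
    (G \ clF M (insert y₃ (((S.erase y₁).erase y₂).erase y₃))).card = 2 + (typeCount (G \ S) (fun x => x ∈ clF M (S.erase w)) (fun x => x ∈ clF M (insert y₁ (((S.erase y₁).erase y₂).erase y₃))) (fun x => x ∈ clF M (insert y₂ (((S.erase y₁).erase y₂).erase y₃))) (fun x => x ∈ clF M (insert y₃ (((S.erase y₁).erase y₂).erase y₃))) true false false false + typeCount (G \ S) (fun x => x ∈ clF M (S.erase w)) (fun x => x ∈ clF M (insert y₁ (((S.erase y₁).erase y₂).erase y₃))) (fun x => x ∈ clF M (insert y₂ (((S.erase y₁).erase y₂).erase y₃))) (fun x => x ∈ clF M (insert y₃ (((S.erase y₁).erase y₂).erase y₃))) true true false false + typeCount (G \ S) (fun x => x ∈ clF M (S.erase w)) (fun x => x ∈ clF M (insert y₁ (((S.erase y₁).erase y₂).erase y₃))) (fun x => x ∈ clF M (insert y₂ (((S.erase y₁).erase y₂).erase y₃))) (fun x => x ∈ clF M (insert y₃ (((S.erase y₁).erase y₂).erase y₃))) true false true false) + (typeCount (G \ S) (fun x => x ∈ clF M (S.erase w)) (fun x => x ∈ clF M (insert y₁ (((S.erase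 y₁).erase y₂).erase y₃))) (fun x => x ∈ clF M (insert y₂ (((S.erase y₁).erase y₂).erase y₃))) (fun x => x ∈ clF M (insert y₃ (((S.erase y₁).erase y₂).erase y₃))) false false false false + typeCount (G \ S) (fun x => x ∈ clF M (S.erase w)) (fun x => x ∈ clF M (insert y₁ (((S.erase y₁).erase y₂).erase y₃))) (fun x => x ∈ clF M (insert y₂ (((S.erase y₁).erase y₂).erase y₃))) (fun x => x ∈ clF M (insert y₃ (((S.erase y₁).erase y₂).erase y₃))) false true false false + typeCount (G \ S) (fun x => x ∈ clF M (S.erase w)) (fun x => x ∈ clF M (insert y₁ (((S.erase y₁).erase y₂).erase y₃))) (fun x => x ∈ clF M (insert y₂ (((S.erase y₁).erase y₂).erase y₃))) (fun x => x ∈ clF M (insert y₃ (((S.erase y₁).erase y₂).erase y₃))) false false true false) ∧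
    gtLoadAt M 5 G (bigP M G) (S.erase y₁) y₁ ≤
      max (rH + faceReq M G (insert y₂ (((S.erase y₁).erase y₂).erase y₃)) + faceReq M G (insert y₃ (((S.erase y₁).erase y₂).erase y₃)) - 11 / 18) 0 /
        ((1 + typeCount (G \ S) (fun x => x ∈ clF M (S.erase w)) (fun x => x ∈ clF M (insert y₁ (((S.erase y₁).erase y₂).erase y₃))) (fun x => x ∈ clF M (insert y₂ (((S.erase y₁).erase y₂).erase y₃))) (fun x => x ∈ clF M (insert y₃ (((S.erase y₁).erase y₂).erase y₃))) true false false false + typeCount (G \ S) (fun x => x ∈ clF M (S.erase w)) (fun x => x ∈ clF M (insert y₁ (((S.erase y₁).erase y₂).erase y₃))) (fun x => x ∈ clF M (insert y₂ (((S.erase y₁).erase y₂).erase y₃))) (fun x => x ∈ clF M (insert y₃ (((S.erase y₁).erase y₂).erase y₃))) true true false false + typeCount (G \ S) (fun x => x ∈ clF M (S.erase w)) (fun x => x ∈ clF M (insert y₁ (((S.erase y₁).erase y₂).erase y₃))) (fun x => x ∈ clF M (insert y₂ (((S.erase y₁).erase y₂).erase y₃))) (fun x => x ∈ clF M (insert y₃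 (((S.erase y₁).erase y₂).erase y₃))) false false false false + (typeCount (G \ S) (fun x => x ∈ clF M (S.erase w)) (fun x => x ∈ clF M (insert y₁ (((S.erase y₁).erase y₂).erase y₃))) (fun x => x ∈ clF M (insert y₂ (((S.erase y₁).erase y₂).erase y₃))) (fun x => x ∈ clF M (insert y₃ (((S.erase y₁).erase y₂).erase y₃))) false true false false + typeCount (G \ S) (fun x => x ∈ clF M (S.erase w)) (fun x => x ∈ clF M (insert y₁ (((S.erase y₁).erase y₂).erase y₃))) (fun x => x ∈ clF M (insert y₂ (((S.erase y₁).erase y₂).erase y₃))) (fun x => x ∈ clF M (insert y₃ (((S.erase y₁).erase y₂).erase y₃))) false false true false + typeCount (G \ S) (fun x => x ∈ clF M (S.erase w)) (fun x => x ∈ clF M (insert y₁ (((S.erase y₁).erase y₂).erase y₃))) (fun x => x ∈ clF M (insert y₂ (((S.erase y₁).erase y₂).erase y₃))) (fun x => x ∈ clF M (insert y₃ (((S.erase y₁).erase y₂).erase y₃))) false false false true) : ℕ) : ℚ) ∧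
    gtLoadAt M 5 G (bigP M G) (S.erase y₂) y₂ ≤
      max (rH + faceReq M G (insert y₁ (((S.erase y₁).erase y₂).erase y₃)) + faceReq M G (insert y₃ (((S.erase y₁).erase y₂).erase y₃)) - 11 / 18) 0 /
        ((1 + typeCount (G \ S) (fun x => x ∈ clF M (S.erase w)) (fun x => x ∈ clF M (insert y₁ (((S.erase y₁).erase y₂).erase y₃))) (fun x => x ∈ clF M (insert y₂ (((S.erase y₁).erase y₂).erase y₃))) (fun x => x ∈ clF M (insert y₃ (((S.erase y₁).erase y₂).erase y₃))) true false false false + typeCount (G \ S) (fun x => x ∈ clF M (S.erase w)) (fun x => x ∈ clF M (insert y₁ (((S.erase y₁).erase y₂).erase y₃))) (fun x => x ∈ clF M (insert y₂ (((S.erase y₁).erase y₂).erase y₃))) (fun x => x ∈ clF M (insert y₃ (((S.erase y₁).erase y₂).erase y₃))) true false true false + typeCount (G \ S) (fun x => x ∈ clF M (S.erase w)) (fun x => x ∈ clF M (insert y₁ (((S.erase y₁).erase y₂).erase y₃))) (fun x => x ∈ clF M (insert y₂ (((S.erase y₁).erase y₂).erase y₃))) (fun x => x ∈ clF M (insert y₃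 (((S.erase y₁).erase y₂).erase y₃))) false false false false + (typeCount (G \ S) (fun x => x ∈ clF M (S.erase w)) (fun x => x ∈ clF M (insert y₁ (((S.erase y₁).erase y₂).erase y₃))) (fun x => x ∈ clF M (insert y₂ (((S.erase y₁).erase y₂).erase y₃))) (fun x => x ∈ clF M (insert y₃ (((S.erase y₁).erase y₂).erase y₃))) false true false false + typeCount (G \ S) (fun x => x ∈ clF M (S.erase w)) (fun x => x ∈ clF M (insert y₁ (((S.erase y₁).erase y₂).erase y₃))) (fun x => x ∈ clF M (insert y₂ (((S.erase y₁).erase y₂).erase y₃))) (fun x => x ∈ clF M (insert y₃ (((S.erase y₁).erase y₂).erase y₃))) false false true false + typeCount (G \ S) (fun x => x ∈ clF M (S.erase w)) (fun x => x ∈ clF M (insert y₁ (((S.erase y₁).erase y₂).erase y₃))) (fun x => x ∈ clF M (insert y₂ (((S.erase y₁).erase y₂).erase y₃))) (fun x => x ∈ clF M (insert y₃ (((S.erase y₁).erase y₂).erase y₃))) false false false true) : ℕ) : ℚ) ∧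
    gtLoadAt M 5 G (bigP M G) (S.erase y₃) y₃ ≤
      max (rH + faceReq M G (insert y₁ (((S.erase y₁).erase y₂).erase y₃)) + faceReq M G (insert y₂ (((S.erase y₁).erase y₂).erase y₃)) - 11 / 18) 0 /
        ((1 + typeCount (G \ S) (fun x => x ∈ clF M (S.erase w)) (fun x => x ∈ clF M (insert y₁ (((S.erase y₁).erase y₂).erase y₃))) (fun x => x ∈ clF M (insert y₂ (((S.erase y₁).erase y₂).erase y₃))) (fun x => x ∈ clF M (insert y₃ (((S.erase y₁).erase y₂).erase y₃))) true false false false + typeCount (G \ S) (fun x => x ∈ clF M (S.erase w)) (fun x => x ∈ clF M (insert y₁ (((S.erase y₁).erase y₂).erase y₃))) (fun x => x ∈ clF M (insert y₂ (((S.erase y₁).erase y₂).erase y₃))) (fun x => x ∈ clF M (insert y₃ (((S.erase y₁).erase y₂).erase y₃))) true false false true + typeCount (G \ S) (fun x => x ∈ clF M (S.erase w)) (fun x => x ∈ clF M (insert y₁ (((S.erase y₁).erase y₂).erase y₃))) (fun x => x ∈ clF M (insert y₂ (((S.erase y₁).erase y₂).erase y₃))) (fun x => x ∈ clF M (insert y₃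 (((S.erase y₁).erase y₂).erase y₃))) false false false false + (typeCount (G \ S) (fun x => x ∈ clF M (S.erase w)) (fun x => x ∈ clF M (insert y₁ (((S.erase y₁).erase y₂).erase y₃))) (fun x => x ∈ clF M (insert y₂ (((S.erase y₁).erase y₂).erase y₃))) (fun x => x ∈ clF M (insert y₃ (((S.erase y₁).erase y₂).erase y₃))) false true false false + typeCount (G \ S) (fun x => x ∈ clF M (S.erase w)) (fun x => x ∈ clF M (insert y₁ (((S.erase y₁).erase y₂).erase y₃))) (fun x => x ∈ clF M (insert y₂ (((S.erase y₁).erase y₂).erase y₃))) (fun x => x ∈ clF M (insert y₃ (((S.erase y₁).erase y₂).erase y₃))) false false true false + typeCount (G \ S) (fun x => x ∈ clF M (S.erase w)) (fun x => x ∈ clF M (insert y₁ (((S.erase y₁).erase y₂).erase y₃))) (fun x => x ∈ clF M (insert y₂ (((S.erase y₁).erase y₂).erase y₃))) (fun x => x ∈ clF M (insert y₃ (((S.erase y₁).erase y₂).erase y₃))) false false false true) : ℕ) : ℚ) := by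
  have hd' : (gr M \ G).card ≤ 5 := by omega
  have hGg : G ⊆ gr M := (mem_flatsQ.1 hG).1
  have hVg : S \ coloops M G ⊆ gr M := Finset.sdiff_subset.trans (hSG.trans hGg)
  have hwc : w ∈ coloops M (S \ coloops M G) := by rw [hc]; exact Finset.mem_singleton_self _
  have hwV : w ∈ S \ coloops M G := (mem_coloops.1 hwc).1
  have hwS : w ∈ S := (Finset.mem_sdiff.1 hwV).1
  have hy₁S : y₁ ∈ S := (Finset.mem_sdiff.1 hy₁V).1
  have hy₂S : y₂ ∈ S := (Finset.mem_sdiff.1 hy₂V).1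
  have hy₃S : y₃ ∈ S := (Finset.mem_sdiff.1 hy₃V).1
  have hy₁w : y₁ ≠ w := fun h => hy₁c (h ▸ hwc)
  have hwy₂ : w ≠ y₂ := fun h => hc₂ (h ▸ hwc)
  have hwy₃ : w ≠ y₃ := fun h => hc₃ (h ▸ hwc)
  have hQ₁V : S.erase y₁ \ coloops M G = (S \ coloops M G).erase y₁ := by
    ext a; simp only [Finset.mem_sdiff, Finset.mem_erase]; tauto
  have hQ₂V : S.erase y₂ \ coloops M G = (S \ coloops M G).erase y₂ := by
    ext a; simp only [Finset.mem_sdiff, Finset.mem_erase]; tauto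
  have hQ₃V : S.erase y₃ \ coloops M G = (S \ coloops M G).erase y₃ := by
    ext a; simp only [Finset.mem_sdiff, Finset.mem_erase]; tauto
  -- the symmetric triple
  obtain ⟨hcol₁', hcol₃'⟩ := coloops_erase_of_triple hVg hV5 hy₁V hy₂V hy₃V h12 h13 h23 hc₂ hc₃ hcol₂ hcol₃
  have hcol₁'' : y₁ ∈ coloops M ((S \ coloops M G).erase y₃) ∧ y₂ ∈ coloops M ((S \ coloops M G).erase y₃) := by
    have := coloops_erase_of_triple hVg hV5 hy₁V hy₃V hy₂V h13 h12 h23.symm hc₃ hc₂ hcol₃ hcol₂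
    exact ⟨this.1, this.2⟩
  -- the faces as insertions into the base
  have hF₁ : (S.erase y₂).erase y₃ = insert y₁ (((S.erase y₁).erase y₂).erase y₃) := by
    ext a; simp only [Finset.mem_erase, Finset.mem_insert]
    constructor
    · rintro ⟨ha3, ha2, haS⟩
      by_cases ha1 : a = y₁
      · exact Or.inl ha1
      · exact Or.inr ⟨ha3, ha2, ha1, haS⟩
    · rintro (rfl | ⟨ha3, ha2, -, haS⟩)
      · exact ⟨h13, h12, hy₁S⟩
      · exact ⟨ha3, ha2, haS⟩
  have hF₂ : (S.erase y₁).erase y₃ = insert y₂ (((S.erase y₁).erase y₂).erase y₃) := face_eq_insert_base' hy₂S h12 h23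
  have hF₃ : (S.erase y₁).erase y₂ = insert y₃ (((S.erase y₁).erase y₂).erase y₃) := face_eq_insert_base hy₃S h13 h23
  -- the closure property and the counts
  have hP1 : ClosureProp (fun x => x ∈ clF M (insert y₁ (((S.erase y₁).erase y₂).erase y₃))) (fun x => x ∈ clF M (insert y₂ (((S.erase y₁).erase y₂).erase y₃))) (fun x => x ∈ clF M (insert y₃ (((S.erase y₁).erase y₂).erase y₃))) := closureProp_faces hG hk hSG hKS hV5 hy₁V hy₂V hy₃V h12 h13 h23 hy₁c hc₂ hc₃ hcol₂ hcol₃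
  have hmH := card_sdiff_clF_erase_coloop hG hk hSG hKS hwc
  rw [card_not_H (H := (fun x => x ∈ clF M (S.erase w))) hP1] at hmH
  have hm₁ := card_sdiff_clF_face_pair hG hk hSG hKS hV5 hy₂V hy₃V h23 hc₂ hc₃ hcol₃' hcol₁''.2
  rw [hF₁, card_not_A₁ (H := (fun x => x ∈ clF M (S.erase w))) hP1] at hm₁
  have hm₂ := card_sdiff_clF_face_pair hG hk hSG hKS hV5 hy₁V hy₃V h13 hy₁c hc₃ hcol₃ hcol₁''.1
  rw [hF₂, card_not_A₁ (H := (fun x => x ∈ clF M (S.erase w))) hP1.swap12] at hm₂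
  have hm₃ := card_sdiff_clF_face_pair hG hk hSG hKS hV5 hy₁V hy₂V h12 hy₁c hc₂ hcol₂ hcol₁'
  rw [hF₃, card_not_A₁ (H := (fun x => x ∈ clF M (S.erase w))) hP1.swap13] at hm₃
  simp only [typeCount_swap12 (A₁ := (fun x => x ∈ clF M (insert y₁ (((S.erase y₁).erase y₂).erase y₃)))) (A₂ := (fun x => x ∈ clF M (insert y₂ (((S.erase y₁).erase y₂).erase y₃))))] at hm₂
  simp only [typeCount_swap13 (A₁ := (fun x => x ∈ clF M (insert y₁ (((S.erase y₁).erase y₂).erase y₃)))) (A₃ := (fun x => x ∈ clF M (insert y₃ (((S.erase y₁).erase y₂).erase y₃))))] at hm₃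
  -- abbreviate the base (opaque, so that the face rewrites do not touch it)
  obtain ⟨P, hP⟩ : ∃ P : Finset α, P = (((S.erase y₁).erase y₂).erase y₃) := ⟨_, rfl⟩
  rw [← hP] at hF₁ hF₂ hF₃ hP1 hmH hm₁ hm₂ hm₃ ⊢
  -- the other faces of each erasure
  have hF₁₂ : (S.erase y₁).erase y₂ = insert y₃ P := hF₃
  have hF₁₃ : (S.erase y₁).erase y₃ = insert y₂ P := hF₂
  have hF₂₃ : (S.erase y₂).erase y₃ = insert y₁ P := hF₁
  have hF₂₁ : (S.erase y₂).erase y₁ = insert y₃ P := by rw [Finset.erase_right_comm]; exact hF₃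
  have hF₃₁ : (S.erase y₃).erase y₁ = insert y₂ P := by rw [Finset.erase_right_comm]; exact hF₂
  have hF₃₂ : (S.erase y₃).erase y₂ = insert y₁ P := by rw [Finset.erase_right_comm]; exact hF₁
  refine ⟨hP1, by omega, by omega, by omega, by omega, ?_, ?_, ?_⟩
  · -- the source `y₁`
    by_cases hsrc₁ : ∃ w' ∈ S.erase y₁, faceLossP M 5 G (bigP M G) (S.erase y₁) w' ≠ 0
    swap
    · push Not at hsrc₁
      rw [gtLoadAt_eq_zero_of_faceLossP_eq_zero _ (fun w' hw' => hsrc₁ w' hw') y₁]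
      positivity
    obtain ⟨w₁, hw₁, h0₁⟩ := hsrc₁
    have hC₁ : coloops M (S.erase y₁ \ coloops M G) = {w, y₂, y₃} :=
      coloops_eq_triple (lossy_structure_of_faceLossP_ne_zero hG hd hk hs hl hw₁ h0₁).2.2.1
        (by rw [hQ₁V]; exact mem_coloops_erase_of_mem_coloops hwc hy₁w.symm) (by rw [hQ₁V]; exact hcol₂)
        (by rw [hQ₁V]; exact hcol₃) hwy₂ hwy₃ h23
    have hg := card_gtPts_ge_outside hG hd hk hs hl hSG hc hy₁S hw₁ h0₁ hC₁ hwy₂ hwy₃ h23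
    rw [hF₁₃, hF₁₂, card_good₁ hP1] at hg
    exact gtLoadAt_le_of_triple hG hd hk hs hl hSG hc hy₁S hw₁ h0₁ hC₁ hwy₂ hwy₃ h23 hF₁₂ hF₁₃
      (hreqw y₁ hy₁V hy₁w hy₁c (Or.inl rfl)) rfl rfl (le_of_eq_of_le (by ring) hg) (by omega)
  · -- the source `y₂`
    by_cases hsrc₂ : ∃ w' ∈ S.erase y₂, faceLossP M 5 G (bigP M G) (S.erase y₂) w' ≠ 0
    swap
    · push Not at hsrc₂
      rw [gtLoadAt_eq_zero_of_faceLossP_eq_zero _ (fun w' hw' => hsrc₂ w' hw') y₂]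
      positivity
    obtain ⟨w₂, hw₂, h0₂⟩ := hsrc₂
    have hC₂ : coloops M (S.erase y₂ \ coloops M G) = {w, y₁, y₃} :=
      coloops_eq_triple (lossy_structure_of_faceLossP_ne_zero hG hd hk hs hl hw₂ h0₂).2.2.1
        (by rw [hQ₂V]; exact mem_coloops_erase_of_mem_coloops hwc hwy₂) (by rw [hQ₂V]; exact hcol₁')
        (by rw [hQ₂V]; exact hcol₃') hy₁w.symm hwy₃ h13
    have hg := card_gtPts_ge_outside hG hd hk hs hl hSG hc hy₂S hw₂ h0₂ hC₂ hy₁w.symm hwy₃ h13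
    rw [hF₂₃, hF₂₁, card_good₁ hP1.swap12] at hg
    simp only [typeCount_swap12 (A₁ := (fun x => x ∈ clF M (insert y₁ P))) (A₂ := (fun x => x ∈ clF M (insert y₂ P)))] at hg
    exact gtLoadAt_le_of_triple hG hd hk hs hl hSG hc hy₂S hw₂ h0₂ hC₂ hy₁w.symm hwy₃ h13 hF₂₁ hF₂₃
      (hreqw y₂ hy₂V hwy₂.symm hc₂ (Or.inr (Or.inl rfl))) rfl rfl (le_of_eq_of_le (by ring) hg) (by omega)
  · -- the source `y₃`
    by_cases hsrc₃ : ∃ w' ∈ S.erase y₃, faceLossP M 5 G (bigP M G) (S.erase y₃) w' ≠ 0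
    swap
    · push Not at hsrc₃
      rw [gtLoadAt_eq_zero_of_faceLossP_eq_zero _ (fun w' hw' => hsrc₃ w' hw') y₃]
      positivity
    obtain ⟨w₃, hw₃, h0₃⟩ := hsrc₃
    have hC₃ : coloops M (S.erase y₃ \ coloops M G) = {w, y₁, y₂} :=
      coloops_eq_triple (lossy_structure_of_faceLossP_ne_zero hG hd hk hs hl hw₃ h0₃).2.2.1
        (by rw [hQ₃V]; exact mem_coloops_erase_of_mem_coloops hwc hwy₃) (by rw [hQ₃V]; exact hcol₁''.1)
        (by rw [hQ₃V]; exact hcol₁''.2) hy₁w.symm hwy₂ h12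
    have hg := card_gtPts_ge_outside hG hd hk hs hl hSG hc hy₃S hw₃ h0₃ hC₃ hy₁w.symm hwy₂ h12
    rw [hF₃₂, hF₃₁, card_good₁ hP1.swap12.swap13] at hg
    simp only [typeCount_swap13 (A₁ := (fun x => x ∈ clF M (insert y₂ P))) (A₂ := (fun x => x ∈ clF M (insert y₁ P))) (A₃ := (fun x => x ∈ clF M (insert y₃ P))),
      typeCount_swap12 (A₁ := (fun x => x ∈ clF M (insert y₁ P))) (A₂ := (fun x => x ∈ clF M (insert y₂ P)))] at hg
    exact gtLoadAt_le_of_triple hG hd hk hs hl hSG hc hy₃S hw₃ h0₃ hC₃ hy₁w.symm hwy₂ h12 hF₃₁ hF₃₂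
      (hreqw y₃ hy₃V hwy₃.symm hc₃ (Or.inr (Or.inr rfl))) rfl rfl (le_of_eq_of_le (by ring) hg) (by omega)

end SidePack

end PercRepro.Shadow
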